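import Summits.QuantumAdvantage.QuantumAdvantage.Theorems.NearExactIsExact.Negative.SkewProductCore
import Summits.QuantumAdvantage.QuantumAdvantage.Theorems.CubicForrelationNearExactIsExactDerivDegree
import Summits.QuantumAdvantage.QuantumAdvantage.Theorems.CubicForrelationNearExactIsExactTenCharacter
import Summits.QuantumAdvantage.QuantumAdvantage.Theorems.CubicForrelationSignedExactCubicForrelationNotPrBPPStubPolarGeometry

/-!
# `NearExactIsExact` (stmt-QuantumAdvantage-14043) — negative lemma THEOREM A (gen 17):
  equivariant skew-product biquadratic permutations never realise the flat residual

**Context (the `31/32` habitat).** By the tree's `MmFormCeiling` trichotomy the only Maiorana–McFarland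
route to a cubic pair with `15/16 < Φ < 1` is a *biquadratic* permutation `π` of `𝔽₂^s` (`π` and `π⁻¹`
of degree `≤ 2`) together with cubics `c₁, c₂` whose residual `c₁ ⊕ c₂∘π` is the indicator `1_U` of a
flat `U` of codimension `6` (`Φ = 1 − 2·2⁻⁶ = 31/32`; DISPROOF.md §10.5, §14, §24 of the b2b cell).
Generations 3 and 7 closed the *affinely triangular* `π` and ran ISD sweeps at `s = 11, 12` with no hit.

**What this file proves (all `s = 6 + r`, no computation).** Take ANY bijection `γ` of `𝔽₂⁶` and any
family `ρ_k : 𝔽₂⁶ → 𝔽₂` (`k < r`) with `ρ_k` and `ρ_k ∘ γ` quadratic, and the skew product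
`π(u,t) = (γ u, t ⊕ ρ(γ u))` on `𝔽₂^{6+r}` (`skewPi`; when `γ` is biquadratic this is exactly the
`T`-equivariant normal form `π(u,t) = (γ u, t ⊕ B u)`, `B = ρ∘γ`, of a biquadratic `π` whose flat
direction `T = 0 × 𝔽₂^r` lies in the radical and is preserved — gen-17 normal form D2). Then for all
cubic `c₁, c₂` on `6 + r` bits, `c₁ ⊕ c₂∘π ≠ 1_{u = 0}` (`skewProduct_residual_ne_flat`). So inside the
`31/32` habitat every surviving `π` must MIX the flat direction into the `u`-block (open sub-cases
F1–F3 of DISPROOF.md §24); the equivariant skew products — which contain the whole gen-3 family `T`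
(`γ = id`) and every "`t ↦ t ⊕ B(u)`" twist of a biquadratic `γ` — are dead for every `r`.

**Proof (parity).** Write `c₂(v,w) = Σ_{|S| ≤ 3} w_S C_S(v)` (`t`-Möbius coefficients `C_S = coefC`,
`deg C_S ≤ 3 − |S|`, `C_S = 0` for `|S| ≥ 4`: `dsum_deg`, `dsum_eq_false`, `expand`). Put
`ĉ(v) = c₂(v, ρ v)` (`texp`) and `ĉ_k(v) = c₂(v, ρ v ⊕ e_k) ⊕ c₂(v, ρ v)` (`tcoef`, `tcoef_eq`). If the
residual were `1_U` then (i) `u ↦ ĉ(γ u) = 1_{u=0} ⊕ c₁(u,0)` has ODD weight, while (ii) each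
`u ↦ ĉ_k(γ u) = c₁(u,e_k) ⊕ c₁(u,0)` is quadratic. The formal Euler identity
`ĉ ⊕ ⨁_k ρ_k ĉ_k = ⨁_{|S| even} ρ_S C_S` (`euler`; on a monomial `w_S` both sides are `(1+|S|) w_S`)
has right-hand side of degree `≤ 2|S| + 3 − |S| ≤ 5 < 6`, hence even weight (Ax/McEliece,
`stub_axParity` at `n = 6, d = 5`); each `ρ_k ĉ_k` has even weight because `(ρ_k ĉ_k) ∘ γ` has degree
`≤ 2 + 2 = 4` and `γ` is a bijection; so `wt ĉ = wt (ĉ ∘ γ)` is even — contradicting (i) (`SkewProductCore.core`).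
Only the bijectivity of `γ` and the quadraticity of `ρ_k, ρ_k∘γ, ĉ_k∘γ` are used, so the statement is
recorded in that generality (`Negative.SkewProductCore`: `texp`, `tcoef`, `euler`, `core`), and the
concrete skew-product statement is derived from it here.

HONEST FRAMING: the value here is a THEOREM (a kernel-checked negative lemma closing one infinite
sub-family of the last Maiorana–McFarland habitat of `NearExactIsExact`), NOT summit progress; the crux
and the summit are untouched.
-/

set_option linter.dupNamespace false -- D-0017: single-problem summit ⇒ `QuantumAdvantage.QuantumAdvantage` by design

namespace Summit.QuantumAdvantage.QuantumAdvantage.Theorems.NearExactIsExact.Negative.SkewProductResidual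

open Finset
open Literature.Computability.QuantumComplexity
open Literature.Computability.QuantumComplexity.BuzetChailloux (bxor)
open Summit.QuantumAdvantage.QuantumAdvantage.Theorems.CubicForrelation.NearExactIsExact
  (fc_isDegLeFun_comp stub_derivDegree tc_const_of_deg_zero)
open Summit.QuantumAdvantage.QuantumAdvantage.Theorems.SignedExactCubicForrelationNotPrBPP.PolarGeometry
  (bxor_bxor_swap)
open Summit.QuantumAdvantage.QuantumAdvantage.Theorems.NearExactIsExact.Negative.SkewProductCore

variable {r : ℕ}

/-! ### The space `𝔽₂^{6+r} = 𝔽₂⁶ × 𝔽₂^r`, the skew product `π`, the flat `U = {u = 0}` -/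

/-- The `u`-block of `x ∈ 𝔽₂^{6+r}`. [folklore] -/
def uPart (x : Fin (6 + r) → Bool) : Fin 6 → Bool := fun i => x (Fin.castAdd r i)

/-- The `t`-block of `x ∈ 𝔽₂^{6+r}`. [folklore] -/
def tPart (x : Fin (6 + r) → Bool) : Fin r → Bool := fun k => x (Fin.natAdd 6 k)

/-- The equivariant skew product `π(u,t) = (γ u, t ⊕ ρ(γ u))`. [folklore] -/
def skewPi (γ : (Fin 6 → Bool) → (Fin 6 → Bool)) (ρ : Fin r → (Fin 6 → Bool) → Bool)
    (x : Fin (6 + r) → Bool) : Fin (6 + r) → Bool :=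
  Fin.append (γ (uPart x)) (fun k => tPart x k ^^ ρ k (γ (uPart x)))

/-- The indicator of the codimension-`6` flat `U = {x : u = 0}`. [folklore] -/
def flatU (x : Fin (6 + r) → Bool) : Bool := decide (∀ i : Fin 6, x (Fin.castAdd r i) = false)

/-- The embedding `u ↦ (u, 0)`. [folklore] -/
def emb (r : ℕ) (u : Fin 6 → Bool) : Fin (6 + r) → Bool := Fin.append u (fun _ => false)

/-- The basis vector `e_{6+k}`. [folklore] -/
def dir (k : Fin r) : Fin (6 + r) → Bool := Fin.append (fun _ : Fin 6 => false) (fun j => decide (j = k))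

/-- The vector `(0, 1_J)`. [folklore] -/
def L (J : Finset (Fin r)) : Fin (6 + r) → Bool := Fin.append (fun _ : Fin 6 => false) (indic J)

/-- `π(u, w) = (γ u, w ⊕ ρ(γ u))`. [folklore] -/
theorem skewPi_append (γ : (Fin 6 → Bool) → (Fin 6 → Bool)) (ρ : Fin r → (Fin 6 → Bool) → Bool)
    (u : Fin 6 → Bool) (w : Fin r → Bool) :
    skewPi γ ρ (Fin.append u w) = Fin.append (γ u) (fun k => w k ^^ ρ k (γ u)) := by
  have hu : uPart (Fin.append u w) = u := funext fun i => Fin.append_left u w i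
  have ht : tPart (Fin.append u w) = w := funext fun k => Fin.append_right u w k
  simp only [skewPi, hu, ht]

/-- `1_U(u, w) = [u = 0]`. [folklore] -/
theorem flatU_append (u : Fin 6 → Bool) (w : Fin r → Bool) :
    flatU (Fin.append u w) = decide (∀ i, u i = false) := by
  simp only [flatU, Fin.append_left]

/-- `(u,0) ⊕ e_{6+k} = (u, e_k)`. [folklore] -/
theorem emb_bxor_dir (u : Fin 6 → Bool) (k : Fin r) :
    bxor (emb r u) (dir k) = Fin.append u (fun j => decide (j = k)) := by
  funext j
  induction j using Fin.addCases with
  | left i => simp [bxor, emb, dir]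
  | right j => simp [bxor, emb, dir]

/-- `(v,0) ⊕ (0,1_J) = (v, 1_J)`. [folklore] -/
theorem emb_bxor_L (v : Fin 6 → Bool) (J : Finset (Fin r)) :
    bxor (emb r v) (L J) = Fin.append v (indic J) := by
  funext j
  induction j using Fin.addCases with
  | left i => simp [bxor, emb, L]
  | right j => simp [bxor, emb, L]

/-- `x ⊕ (0, 1_∅) = x`. [folklore] -/
theorem bxor_L_empty (x : Fin (6 + r) → Bool) : bxor x (L (∅ : Finset (Fin r))) = x := by
  funext j
  induction j using Fin.addCases with
  | left i => simp [bxor, L]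
  | right j => simp [bxor, L, indic]

/-- `(0, 1_{J ∪ {k}}) = (0, 1_J) ⊕ e_{6+k}` for `k ∉ J`. [folklore] -/
theorem L_insert {J : Finset (Fin r)} {k : Fin r} (hk : k ∉ J) : L (insert k J) = bxor (L J) (dir k) := by
  funext j
  induction j using Fin.addCases with
  | left i => simp [bxor, L, dir]
  | right j =>
    simp only [bxor, L, dir, indic, Fin.append_right]
    by_cases h : j = k
    · subst h; simp [hk]
    · simp [h]

/-- The coordinates of `u ↦ (u, 0)` are affine. [folklore] -/
theorem emb_coord_deg (r : ℕ) : ∀ j : Fin (6 + r), IsDegLeFun 1 (fun u : Fin 6 → Bool => emb r u j) := by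
  intro j
  induction j using Fin.addCases with
  | left i =>
    have e : (fun u : Fin 6 → Bool => emb r u (Fin.castAdd r i)) = fun u => u i :=
      funext fun u => Fin.append_left u _ i
    rw [e]
    exact isDegLeFun_apply i le_rfl
  | right k =>
    have e : (fun u : Fin 6 → Bool => emb r u (Fin.natAdd 6 k)) = fun _ => false :=
      funext fun u => Fin.append_right u _ k
    rw [e]
    exact isDegLeFun_const 1 false

/-! ### `t`-Möbius coefficients of a cubic: degree, truncation, expansion -/

/-- `dsum c S x = ⨁_{J ⊆ S} c(x ⊕ (0,1_J))`: the iterated derivative of `c` in the directions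
`e_{6+k}, k ∈ S`. [folklore] -/
def dsum (c : (Fin (6 + r) → Bool) → Bool) (S : Finset (Fin r)) (x : Fin (6 + r) → Bool) : Bool :=
  decide ((∑ J ∈ S.powerset, ind (c (bxor x (L J)))) = 1)

/-- The `t`-Möbius coefficients `C_S(v) = dsum c S (v, 0)`. [folklore] -/
def coefC (c : (Fin (6 + r) → Bool) → Bool) : Finset (Fin r) → (Fin 6 → Bool) → Bool :=
  fun S v => dsum c S (emb r v)

/-- One more direction is one more derivative. [folklore] -/
theorem dsum_insert (c : (Fin (6 + r) → Bool) → Bool) {S : Finset (Fin r)} {k : Fin r} (hk : k ∉ S) :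
    dsum c (insert k S) = fun x => dsum c S x ^^ dsum c S (bxor x (dir k)) := by
  funext x
  have hB : ∑ J ∈ S.powerset, ind (c (bxor x (L (insert k J)))) =
      ∑ J ∈ S.powerset, ind (c (bxor (bxor x (dir k)) (L J))) :=
    sum_congr rfl fun J hJ => by
      have hkJ : k ∉ J := fun h => hk (mem_powerset.mp hJ h)
      rw [L_insert hkJ, bxor_bxor_swap]
  simp only [dsum]
  rw [sum_powerset_insert hk, hB, zmod2_decide_add]

/-- `deg (dsum c S) ≤ 3 − |S|` for cubic `c`. [folklore] -/
theorem dsum_deg (c : (Fin (6 + r) → Bool) → Bool) (hc : IsDegLeFun 3 c) :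
    ∀ S : Finset (Fin r), IsDegLeFun (3 - S.card) (dsum c S) := by
  intro S
  induction S using Finset.induction_on with
  | empty =>
    have e : dsum c ∅ = c := by
      funext x; simp only [dsum, powerset_empty, sum_singleton, bxor_L_empty, decide_ind_eq_one]
    rw [e, card_empty]
    exact hc
  | insert k S hk ih =>
    rw [dsum_insert c hk, card_insert_of_notMem hk]
    exact stub_derivDegree (6 + r) (3 - (S.card + 1)) (dsum c S) (dir k) (ih.mono (by omega))

/-- Four `t`-derivatives kill a cubic: `dsum c S = 0` for `|S| ≥ 4`. [folklore] -/
theorem dsum_eq_false (c : (Fin (6 + r) → Bool) → Bool) (hc : IsDegLeFun 3 c) {S : Finset (Fin r)}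
    (hS : 3 < S.card) (x : Fin (6 + r) → Bool) : dsum c S x = false := by
  obtain ⟨k, hk⟩ : S.Nonempty := card_pos.mp (by omega)
  have hS' : S = insert k (S.erase k) := (insert_erase hk).symm
  have h0 : IsDegLeFun 0 (dsum c (S.erase k)) := by
    have h := dsum_deg c hc (S.erase k)
    rw [card_erase_of_mem hk] at h
    have h00 : 3 - (S.card - 1) = 0 := by omega
    rwa [h00] at h
  rw [hS', dsum_insert c (notMem_erase k S)]
  show (dsum c (S.erase k) x ^^ dsum c (S.erase k) (bxor x (dir k))) = false
  rw [tc_const_of_deg_zero h0 x (bxor x (dir k)), Bool.xor_self]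

/-- `deg C_S ≤ 3 − |S|`. [folklore] -/
theorem coefC_deg (c : (Fin (6 + r) → Bool) → Bool) (hc : IsDegLeFun 3 c) (S : Finset (Fin r)) :
    IsDegLeFun (3 - S.card) (coefC c S) :=
  fc_isDegLeFun_comp (dsum_deg c hc S) (emb r) (emb_coord_deg r) (le_of_eq (one_mul _))

/-- **Expansion.** `c(v, w) = Σ_{|S| ≤ 3} w_S C_S(v)` for cubic `c`, i.e. `ind (c (v,w)) = texp (coefC c) w v`.
[folklore] -/
theorem expand (c : (Fin (6 + r) → Bool) → Bool) (hc : IsDegLeFun 3 c) (v : Fin 6 → Bool)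
    (w : Fin r → Bool) : ind (c (Fin.append v w)) = texp (coefC c) w v := by
  have hm := sum_powerset_sum_powerset (fun J => ind (c (bxor (emb r v) (L J)))) (supp w)
  rw [emb_bxor_L, indic_supp] at hm
  rw [← hm]
  have ht : texp (coefC c) w v = ∑ S, (∏ j ∈ S, ind (w j)) * ind (coefC c S v) := by
    simp only [texp]
    rw [P3, sum_filter]
    refine sum_congr rfl fun S _ => ?_
    split_ifs with h3
    · rfl
    · rw [coefC, dsum_eq_false c hc (not_le.mp h3), ind_false, mul_zero]
  rw [ht]
  simp only [coefC, dsum, ind_decide_eq_one]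
  exact sum_powerset_supp w _

/-! ### THEOREM A -/

/-- **THEOREM A (gen 17).** For any bijection `γ` of `𝔽₂⁶`, any `ρ_k` with `ρ_k` and `ρ_k ∘ γ`
quadratic, and any cubic `c₁, c₂` on `6 + r` bits, the residual `c₁ ⊕ c₂ ∘ π` of the skew product
`π(u,t) = (γ u, t ⊕ ρ(γ u))` is NOT the indicator of the flat `{u = 0}`. In particular no
`T`-equivariant biquadratic `π` (flat direction radical and preserved) yields a Maiorana–McFarland
cubic pair with `Φ = 31/32` — for every number `r` of `t`-variables. [folklore] -/
theorem skewProduct_residual_ne_flat (γ : (Fin 6 → Bool) → (Fin 6 → Bool)) (hγ : Function.Bijective γ)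
    (ρ : Fin r → (Fin 6 → Bool) → Bool) (hρ : ∀ k, IsDegLeFun 2 (ρ k))
    (hργ : ∀ k, IsDegLeFun 2 (fun u => ρ k (γ u)))
    (c₁ c₂ : (Fin (6 + r) → Bool) → Bool) (h₁ : IsDegLeFun 3 c₁) (h₂ : IsDegLeFun 3 c₂) :
    ¬ ∀ x, (c₁ x ^^ c₂ (skewPi γ ρ x)) = flatU x := by
  intro h
  -- the residual equation on the fibre through `(u, w)`
  have hx : ∀ (u : Fin 6 → Bool) (w : Fin r → Bool),
      c₂ (Fin.append (γ u) (fun k => w k ^^ ρ k (γ u))) = (c₁ (Fin.append u w) ^^ decide (∀ i, u i = false)) := by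
    intro u w
    have h' := h (Fin.append u w)
    rw [skewPi_append, flatU_append] at h'
    exact bool_solve _ _ _ h'
  have h0 : ∀ u : Fin 6 → Bool,
      c₂ (Fin.append (γ u) (fun j => ρ j (γ u))) = (c₁ (emb r u) ^^ decide (∀ i, u i = false)) := by
    intro u
    have h' := hx u (fun _ => false)
    simp only [Bool.false_xor] at h'
    exact h'
  -- (ii) every `ĉ_k ∘ γ` is quadratic
  have hk : ∀ k, IsDegLeFun 2 (fun u => decide (tcoef ρ (coefC c₂) k (γ u) = 1)) := by
    intro k
    have e : (fun u => decide (tcoef ρ (coefC c₂) k (γ u) = 1)) =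
        fun u => (c₁ (emb r u) ^^ c₁ (bxor (emb r u) (dir k))) := by
      funext u
      rw [tcoef_eq, zmod2_decide_add, ← expand c₂ h₂, ← expand c₂ h₂, decide_ind_eq_one, decide_ind_eq_one,
        emb_bxor_dir, hx u (fun j => decide (j = k)), h0 u]
      exact bool_cancel _ _ _
    rw [e]
    exact fc_isDegLeFun_comp (stub_derivDegree (6 + r) 2 c₁ (dir k) h₁) (emb r) (emb_coord_deg r)
      (by norm_num)
  -- so `ĉ` has even weight ...
  have hcore := core hγ hρ hργ (coefC_deg c₂ h₂) hk
  have hsum1 : ∑ u, ind (c₂ (Fin.append (γ u) (fun j => ρ j (γ u)))) = 0 := by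
    rw [← hcore]
    simp_rw [expand c₂ h₂]
    exact Fintype.sum_bijective γ hγ _ _ (fun u => rfl)
  -- ... but (i) `ĉ ∘ γ = c₁(·,0) ⊕ 1_{u = 0}` has odd weight
  have hc₁ : ∑ u, ind (c₁ (emb r u)) = 0 :=
    sum_ind_eq_zero_of_deg_five (fc_isDegLeFun_comp h₁ (emb r) (emb_coord_deg r) (by norm_num))
  have hδ : ∑ u : Fin 6 → Bool, ind (decide (∀ i, u i = false)) = 1 := by
    rw [Finset.sum_eq_single (fun _ => false)]
    · simp
    · intro u _ hu
      have hu' : ¬ ∀ i, u i = false := fun h' => hu (funext h')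
      simp [hu']
    · intro h'
      exact absurd (mem_univ _) h'
  have hsum2 : ∑ u, ind (c₂ (Fin.append (γ u) (fun j => ρ j (γ u)))) = 1 := by
    simp_rw [h0, ind_xor]
    rw [sum_add_distrib, hc₁, hδ, zero_add]
  exact zero_ne_one (hsum1.symm.trans hsum2)

end Summit.QuantumAdvantage.QuantumAdvantage.Theorems.NearExactIsExact.Negative.SkewProductResidual
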